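import Summits.Ventures.YMGap.FlowData.TubeFluxNonAnnihilation
import Summits.Ventures.YMGap.Conjectures.TubeStringTension
import Summits.Ventures.YMGap.FlowData.TubeSchurTest
import HarnessLib

/-!
# Venture YMGap, track Y3 FLOW-DATA — an a-priori TWO-SIDED ENVELOPE for the torelon energy of every cubic tube:
# `0 < E₁((ℤ/L)^k; β) ≤ L · (−ln u(β)) + 2 β · #(spatial plaquettes)` (theorems only)

HONEST FRAMING: venture file of the cell `pub-ymgap` (QuantumFields programme), track Y3; companion THEOREMS for
`FlowData/TorelonEnergy.lean` and the typed law `Conjectures/TubeStringTension.lean` (text untouched).  A crude but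
RIGOROUS upper envelope for every `E₁` entry of the FLOW-TABLE, generalising the d = 2 anchor (`k = 1`: no spatial
plaquettes, `E₁ ≤ L(−ln u)`): the strong-coupling value plus `2β` per spatial plaquette.  It is NOT the law
`E₁ < L(−ln u)` (which stays an open EMPIRICAL LAW) and says nothing about `L → ∞`, the continuum or a mass gap.

* Schur's test (`FlowData/TubeSchurTest.lean`, `norm_kernelOp_le_of_integral_le`: a non-negative bounded
  kernel with row and column integrals `≤ R` defines an `L²` operator of norm `≤ R`);
* `abs_magSum_le` — `|magSum| ≤ n · #plaquettes`; `integral_sliceKernel_le` — the row integrals of the slice kernel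
  are `≤ e^{|J| n P} c₀^N` (`c₀ = ∫ e^{J Re tr ρ}`, `N` links, `P` plaquettes; temporal links gauged away against the
  gauge-invariant `e^{J mag/2}`), hence **`norm_tubeTransferOperator_le`**: `‖T‖ ≤ e^{|J| n P} c₀^N`;
* **`tubeSectorNorm_single_ge`** — the Polyakov-line state gives `‖T ∘ P_{ê_μ}‖ ≥ e^{−|J| n P} c₀^{N−L} λ^L`
  (`λ` the Schur scalar);
* **`su2TorelonEnergy_le_envelope`** — for `SU(2)`, `β > 0`:
  `su2TorelonEnergy β k L μ ≤ L · (−log (su2CharacterRatio β)) + 2β · #(Plaquette k L)`.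

References: P. R. Halmos, V. S. Sunder, *Bounded Integral Operators on L² Spaces* (1978) Thm 5.2 [folklore];
I. Montvay, G. Münster (1994) §3.2.6 [cite: MontvayMunster1994, §3.2.6]; G. Münster, Nucl. Phys. B 180 (1981) 23
[folklore].
-/

noncomputable section

open scoped BigOperators ENNReal
open MeasureTheory Filter Function
open Literature.MathematicalPhysics.QuantumFieldTheory Literature.Analysis.OperatorTheory
open Literature.Barriers.QuantumFields

namespace Summit.Ventures.YMGap.FlowData


/-! ### Bounds for the slice kernel: `|magSum| ≤ n P`, row sums, `‖T‖` -/

section Bounds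

variable {G : Type*} [Group G] [TopologicalSpace G] [IsTopologicalGroup G] [CompactSpace G]
  [MeasurableSpace G] [BorelSpace G] [SecondCountableTopology G] {n : ℕ} (ρ : G →* Matrix (Fin n) (Fin n) ℂ)
  (J : ℝ) {k L : ℕ} [NeZero L]

omit [TopologicalSpace G] [IsTopologicalGroup G] [CompactSpace G] [MeasurableSpace G] [BorelSpace G]
  [SecondCountableTopology G] in
/-- `|magSum a| ≤ n · #(plaquettes)` for unitary `ρ` (`|Re tr ρ| ≤ n`). [folklore] -/
theorem abs_magSum_le (hρu : ∀ g, ρ g ∈ Matrix.unitaryGroup (Fin n) ℂ) (a : GaugeConfig k L G) :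
    |magSum (d := k) (L := L) ρ a| ≤ n * Fintype.card (Plaquette k L) := by
  unfold magSum
  refine (Finset.abs_sum_le_sum_abs _ _).trans ?_
  have h : ∀ x : Site k L, |∑ p : {p : Fin k × Fin k // p.1 < p.2},
      (ρ (a (x, p.1.1) * a (x + Pi.single p.1.1 1, p.1.2) * (a (x + Pi.single p.1.2 1, p.1.1))⁻¹ *
        (a (x, p.1.2))⁻¹)).trace.re| ≤ ∑ _p : {p : Fin k × Fin k // p.1 < p.2}, (n : ℝ) := fun x =>
    (Finset.abs_sum_le_sum_abs _ _).trans (Finset.sum_le_sum fun p _ =>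
      (Complex.abs_re_le_norm _).trans (FiniteTemperature.norm_trace_le_of_mem_unitaryGroup (hρu _)))
  refine (Finset.sum_le_sum fun x _ => h x).trans (le_of_eq ?_)
  simp only [Finset.sum_const, Finset.card_univ, Fintype.card_prod]
  push_cast
  ring

omit [TopologicalSpace G] [IsTopologicalGroup G] [CompactSpace G] [MeasurableSpace G] [BorelSpace G]
  [SecondCountableTopology G] in
/-- `e^{J mag(a)/2} ≤ e^{|J| n P / 2}`. [folklore] -/
theorem exp_half_magSum_le (hρu : ∀ g, ρ g ∈ Matrix.unitaryGroup (Fin n) ℂ) (a : GaugeConfig k L G) :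
    Real.exp (J / 2 * magSum (d := k) (L := L) ρ a) ≤ Real.exp (|J| * (n * Fintype.card (Plaquette k L)) / 2) := by
  refine Real.exp_le_exp.2 ?_
  have h := abs_magSum_le ρ hρu a
  have h2 : J * magSum (d := k) (L := L) ρ a ≤ |J| * (n * Fintype.card (Plaquette k L)) :=
    (le_abs_self _).trans (by rw [abs_mul]; exact mul_le_mul_of_nonneg_left h (abs_nonneg _))
  linarith

omit [TopologicalSpace G] [IsTopologicalGroup G] [CompactSpace G] [MeasurableSpace G] [BorelSpace G]
  [SecondCountableTopology G] in
/-- `e^{−J mag(b)} ≤ e^{|J| n P}`. [folklore] -/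
theorem exp_neg_magSum_le (hρu : ∀ g, ρ g ∈ Matrix.unitaryGroup (Fin n) ℂ) (b : GaugeConfig k L G) :
    Real.exp (-(J * magSum (d := k) (L := L) ρ b)) ≤ Real.exp (|J| * (n * Fintype.card (Plaquette k L))) := by
  refine Real.exp_le_exp.2 ?_
  have h := abs_magSum_le ρ hρu b
  have h1 : -(J * magSum (d := k) (L := L) ρ b) ≤ |J * magSum (d := k) (L := L) ρ b| := neg_le_abs _
  rw [abs_mul] at h1
  exact h1.trans (mul_le_mul_of_nonneg_left h (abs_nonneg _))

/-- **Row integrals of the slice kernel**: `∫ K(a, b) db ≤ e^{|J| n P} c₀^N` (the temporal links gauge away against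
the gauge-invariant `e^{J mag(b)/2}`; `c₀ = ∫ e^{J Re tr ρ}`, `N` links, `P` plaquettes). [cite: MontvayMunster1994, §3.2.6] -/
theorem integral_sliceKernel_le (hρ : Continuous ρ) (hρu : ∀ g, ρ g ∈ Matrix.unitaryGroup (Fin n) ℂ)
    (a : GaugeConfig k L G) :
    ∫ b, sliceKernel (d := k) (L := L) ρ J J a b ∂(sliceMeasure G k L) ≤
      Real.exp (|J| * (n * Fintype.card (Plaquette k L))) *
        (∫ g, Real.exp (J * (ρ g).trace.re) ∂haarProbability G) ^ Fintype.card (Edge k L) := by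
  set P : ℝ := n * Fintype.card (Plaquette k L) with hP
  have hF : Continuous fun b : GaugeConfig k L G => Real.exp (J / 2 * magSum (d := k) (L := L) ρ b) :=
    Real.continuous_exp.comp (continuous_const.mul (continuous_magSum (d := k) (L := L) ρ hρ))
  have hFg : ∀ (γ : Site k L → G) (b : GaugeConfig k L G),
      Real.exp (J / 2 * magSum (d := k) (L := L) ρ (gaugeTransform γ b)) = Real.exp (J / 2 * magSum (d := k) (L := L) ρ b) :=
    fun γ b => by rw [magSum_gaugeTransform]
  have h1 : ∫ b, sliceKernel (d := k) (L := L) ρ J J a b ∂(sliceMeasure G k L) =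
      Real.exp (J / 2 * magSum (d := k) (L := L) ρ a) *
        ∫ c, (∏ e : Edge k L, Real.exp (J * (ρ (c e)).trace.re)) *
          Real.exp (J / 2 * magSum (d := k) (L := L) ρ (c * a)) ∂(sliceMeasure G k L) := by
    unfold sliceKernel
    simp_rw [mul_assoc]
    rw [integral_const_mul, integral_integral_exp_elecSum_mul ρ J hρ hF hFg a]
  rw [h1]
  have hw0 : ∀ c : GaugeConfig k L G, 0 ≤ ∏ e : Edge k L, Real.exp (J * (ρ (c e)).trace.re) :=
    fun c => Finset.prod_nonneg fun e _ => (Real.exp_pos _).le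
  have hwc : Continuous fun c : GaugeConfig k L G => ∏ e : Edge k L, Real.exp (J * (ρ (c e)).trace.re) :=
    continuous_finsetProd _ fun e _ =>
      Real.continuous_exp.comp (continuous_const.mul ((Complex.continuous_re.comp hρ.matrix_trace).comp (continuous_apply e)))
  have h2 : ∫ c, (∏ e : Edge k L, Real.exp (J * (ρ (c e)).trace.re)) *
        Real.exp (J / 2 * magSum (d := k) (L := L) ρ (c * a)) ∂(sliceMeasure G k L) ≤
      ∫ c, (∏ e : Edge k L, Real.exp (J * (ρ (c e)).trace.re)) * Real.exp (|J| * P / 2) ∂(sliceMeasure G k L) := by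
    refine integral_mono_of_nonneg (Eventually.of_forall fun c => mul_nonneg (hw0 c) (Real.exp_pos _).le)
      ((hwc.mul continuous_const).integrable_of_hasCompactSupport (HasCompactSupport.of_compactSpace _))
      (Eventually.of_forall fun c => mul_le_mul_of_nonneg_left (exp_half_magSum_le ρ J hρu _) (hw0 c))
  rw [integral_mul_const] at h2
  have h3 : ∫ c, ∏ e : Edge k L, Real.exp (J * (ρ (c e)).trace.re) ∂(sliceMeasure G k L) =
      (∫ g, Real.exp (J * (ρ g).trace.re) ∂haarProbability G) ^ Fintype.card (Edge k L) :=
    integral_fintype_prod_eq_pow (ι := Edge k L) (μ := haarProbability G) (fun g : G => Real.exp (J * (ρ g).trace.re))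
  rw [h3] at h2
  have hc0 : 0 ≤ (∫ g, Real.exp (J * (ρ g).trace.re) ∂haarProbability G) ^ Fintype.card (Edge k L) :=
    pow_nonneg (integral_nonneg fun g => (Real.exp_pos _).le) _
  calc Real.exp (J / 2 * magSum (d := k) (L := L) ρ a) *
        ∫ c, (∏ e : Edge k L, Real.exp (J * (ρ (c e)).trace.re)) *
          Real.exp (J / 2 * magSum (d := k) (L := L) ρ (c * a)) ∂(sliceMeasure G k L)
      ≤ Real.exp (|J| * P / 2) * ((∫ g, Real.exp (J * (ρ g).trace.re) ∂haarProbability G) ^ Fintype.card (Edge k L) *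
          Real.exp (|J| * P / 2)) :=
        mul_le_mul (exp_half_magSum_le ρ J hρu a) h2
          (integral_nonneg fun c => mul_nonneg (hw0 c) (Real.exp_pos _).le) (Real.exp_pos _).le
    _ = Real.exp (|J| * P) * (∫ g, Real.exp (J * (ρ g).trace.re) ∂haarProbability G) ^ Fintype.card (Edge k L) := by
        rw [show |J| * P = |J| * P / 2 + |J| * P / 2 by ring, Real.exp_add]; ring

/-- **`‖T‖ ≤ e^{|J| n P} c₀^N`** (Schur's test with the symmetric slice kernel). [folklore] -/
theorem norm_tubeTransferOperator_le (hρ : Continuous ρ) (hρu : ∀ g, ρ g ∈ Matrix.unitaryGroup (Fin n) ℂ) :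
    ‖tubeTransferOperator ρ J k L‖ ≤ Real.exp (|J| * (n * Fintype.card (Plaquette k L))) *
      (∫ g, Real.exp (J * (ρ g).trace.re) ∂haarProbability G) ^ Fintype.card (Edge k L) := by
  obtain ⟨C, hC⟩ := exists_sliceKernel_le (d := k) (L := L) ρ hρ J J
  refine norm_kernelOp_le_of_integral_le (stronglyMeasurable_uncurry_sliceKernel J k L hρ) hC
    (fun a b => (sliceKernel_pos (d := k) (L := L) ρ hρ J J a b).le)
    (mul_nonneg (Real.exp_pos _).le (pow_nonneg (integral_nonneg fun g => (Real.exp_pos _).le) _))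
    (fun a => integral_sliceKernel_le ρ J hρ hρu a) (fun b => ?_) (tubeTransferOperator_ae_eq J k L hρ)
  simp_rw [sliceKernel_symm (d := k) (L := L) ρ hρu J J _ b]
  exact integral_sliceKernel_le ρ J hρ hρu b

end Bounds

/-! ### The lower bound on the axial sector top and the envelope -/

section Envelope

variable {G : Type*} [Group G] [TopologicalSpace G] [IsTopologicalGroup G] [CompactSpace G]
  [MeasurableSpace G] [BorelSpace G] [SecondCountableTopology G] {n : ℕ} (ρ : G →* Matrix (Fin n) (Fin n) ℂ)
  (J : ℝ) {k L : ℕ} [NeZero L]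

/-- **Variational lower bound on the axial sector top**: `e^{−|J| n P} c₀^{N−L} λ^L ≤ ‖T ∘ P_{ê_μ}‖` whenever
(`λ` the Schur scalar of the one-link weight; `ρ(z) = −1`, `z` central, unitary continuous `ρ`, `n ≠ 0`) — the
Polyakov-line state of `TubeFluxNonAnnihilation.lean`, whose norm is at most `e^{|J| n P/2}` times that of its trace.
[folklore] -/
theorem tubeSectorNorm_single_ge (hρ : Continuous ρ) (hρu : ∀ g, ρ g ∈ Matrix.unitaryGroup (Fin n) ℂ) (hn : n ≠ 0)
    {z : G} (hz : z ∈ Subgroup.center G) (hρz : ρ z = -1) {lam : ℝ}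
    (hM : ∀ i j, ∫ c, (Real.exp (J * (ρ c).trace.re) : ℂ) * ρ c i j ∂haarProbability G = if i = j then (lam : ℂ) else 0)
    (μ : Fin k) :
    Real.exp (-(|J| * (n * Fintype.card (Plaquette k L)))) *
        ((∫ g, Real.exp (J * (ρ g).trace.re) ∂haarProbability G) ^ (Fintype.card (Edge k L) - L) * lam ^ L) ≤
      tubeSectorNorm ρ z J k L (Pi.single μ 1) := by
  set ℓ : Fin L → Edge k L := fun t => (Pi.single μ ((t : ℕ) : ZMod L), μ) with hℓ
  set W : GaugeConfig k L G → ℝ := fun b => (ρ ((List.ofFn fun t : Fin L => b (ℓ t)).prod)).trace.re with hW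
  set f : GaugeConfig k L G → ℝ := fun b => Real.exp (-(J / 2 * magSum (d := k) (L := L) ρ b)) * W b with hf
  set P : ℝ := n * Fintype.card (Plaquette k L) with hP
  have hWc : Continuous W :=
    Complex.continuous_re.comp ((hρ.comp (continuous_prod_ofFn_apply L ℓ)).matrix_trace)
  have hfc : Continuous f :=
    (Real.continuous_exp.comp (continuous_const.mul (continuous_magSum (d := k) (L := L) ρ hρ)).neg).mul hWc
  obtain ⟨Cf, hCf⟩ := isCompact_univ.exists_bound_of_continuousOn hfc.continuousOn
  have hmem : MemLp f 2 (sliceMeasure G k L) :=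
    MemLp.of_bound hfc.aestronglyMeasurable Cf (Eventually.of_forall fun b => hCf b (Set.mem_univ _))
  have heig : ∀ s : Fin k → ZMod 2, fluxTwistOp k L z s (hmem.toLp f) = fluxSign (Pi.single μ 1) s • hmem.toLp f := by
    intro s
    refine fluxTwistOp_toLp_eq_smul z s hmem _ fun b => ?_
    have hWs : W (fluxTwist z s b) = fluxSign (Pi.single μ 1) s * W b := by
      simp only [hW, hℓ]; exact lineTrace_fluxTwist ρ hρz μ s b
    simp only [hf]
    rw [magSum_fluxTwist ρ hz, hWs]
    ring
  have hP1 : tubeFluxProjection z k L (Pi.single μ 1) (hmem.toLp f) = hmem.toLp f :=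
    tubeFluxProjection_apply_of_twist_eigen z heig
  have hinner := inner_tubeTransferOperator_pathState ρ J hρ hM ℓ (line_injective μ) (lineTrace_gaugeTransform ρ μ) hmem
  -- `‖ψ‖² ≤ e^{|J| n P} ∫ W²`
  have hW2i : Integrable (fun b => W b ^ 2) (sliceMeasure G k L) :=
    (hWc.pow 2).integrable_of_hasCompactSupport (HasCompactSupport.of_compactSpace _)
  have hnorm : ‖hmem.toLp f‖ ^ 2 ≤ Real.exp (|J| * P) * ∫ b, W b ^ 2 ∂(sliceMeasure G k L) := by
    rw [norm_sq_eq_integral_sq, ← integral_const_mul]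
    have hae := hmem.coeFn_toLp
    refine integral_mono_ae ((Lp.memLp (hmem.toLp f)).integrable_sq) (hW2i.const_mul _) ?_
    filter_upwards [hae] with b hb
    rw [hb]
    simp only [hf]
    rw [mul_pow, ← Real.exp_nat_mul]
    have h2 : ((2 : ℕ) : ℝ) * -(J / 2 * magSum (d := k) (L := L) ρ b) = -(J * magSum (d := k) (L := L) ρ b) := by
      push_cast; ring
    rw [h2]
    exact mul_le_mul_of_nonneg_right (exp_neg_magSum_le ρ J hρu b) (sq_nonneg _)
  -- `⟪ψ, Tψ⟫ = ⟪ψ, (T P) ψ⟫ ≤ ‖T P‖ ‖ψ‖²`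
  have hle : (∫ g, Real.exp (J * (ρ g).trace.re) ∂haarProbability G) ^ (Fintype.card (Edge k L) - L) * lam ^ L *
      ∫ b, W b ^ 2 ∂(sliceMeasure G k L) ≤ tubeSectorNorm ρ z J k L (Pi.single μ 1) * ‖hmem.toLp f‖ ^ 2 := by
    rw [← hinner]
    have h := real_inner_le_norm (hmem.toLp f)
      (((tubeTransferOperator ρ J k L).comp (tubeFluxProjection z k L (Pi.single μ 1))) (hmem.toLp f))
    rw [ContinuousLinearMap.comp_apply, hP1] at h
    refine h.trans ?_
    have h2 := ((tubeTransferOperator ρ J k L).comp (tubeFluxProjection z k L (Pi.single μ 1))).le_opNorm (hmem.toLp f)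
    rw [ContinuousLinearMap.comp_apply, hP1] at h2
    unfold tubeSectorNorm sectorNorm
    calc ‖hmem.toLp f‖ * ‖tubeTransferOperator ρ J k L (hmem.toLp f)‖
        ≤ ‖hmem.toLp f‖ * (‖(tubeTransferOperator ρ J k L).comp (tubeFluxProjection z k L (Pi.single μ 1))‖ *
            ‖hmem.toLp f‖) := mul_le_mul_of_nonneg_left h2 (norm_nonneg _)
      _ = ‖(tubeTransferOperator ρ J k L).comp (tubeFluxProjection z k L (Pi.single μ 1))‖ * ‖hmem.toLp f‖ ^ 2 := by
          ring
  have hc0 : 0 ≤ (∫ g, Real.exp (J * (ρ g).trace.re) ∂haarProbability G) ^ (Fintype.card (Edge k L) - L) :=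
    pow_nonneg (integral_nonneg fun g => (Real.exp_pos _).le) _
  have hS0 : 0 ≤ tubeSectorNorm ρ z J k L (Pi.single μ 1) := sectorNorm_nonneg _ _ _
  -- combine: `c λ^L ∫W² ≤ S ‖ψ‖² ≤ S e^{|J|P} ∫W²`
  have h3 : (∫ g, Real.exp (J * (ρ g).trace.re) ∂haarProbability G) ^ (Fintype.card (Edge k L) - L) * lam ^ L *
      ∫ b, W b ^ 2 ∂(sliceMeasure G k L) ≤
      tubeSectorNorm ρ z J k L (Pi.single μ 1) * (Real.exp (|J| * P) * ∫ b, W b ^ 2 ∂(sliceMeasure G k L)) :=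
    hle.trans (mul_le_mul_of_nonneg_left hnorm hS0)
  have hW1 : W 1 = n := by
    have h : (List.ofFn fun t : Fin L => (1 : GaugeConfig k L G) (ℓ t)).prod = 1 := by
      simp only [Pi.one_apply, List.ofFn_const, List.prod_replicate, one_pow]
    simp only [hW, h, map_one, Matrix.trace_one, Fintype.card_fin, Complex.natCast_re]
  have hW2pos : 0 < ∫ b, W b ^ 2 ∂(sliceMeasure G k L) :=
    Continuous.integral_pos_of_hasCompactSupport_nonneg_nonzero (x := 1) (hWc.pow 2)
      (HasCompactSupport.of_compactSpace _) (fun b => sq_nonneg _)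
      (by rw [hW1]; exact pow_ne_zero 2 (Nat.cast_ne_zero.2 hn))
  have hexp : 0 < Real.exp (|J| * P) := Real.exp_pos _
  have h4 : (∫ g, Real.exp (J * (ρ g).trace.re) ∂haarProbability G) ^ (Fintype.card (Edge k L) - L) * lam ^ L ≤
      tubeSectorNorm ρ z J k L (Pi.single μ 1) * Real.exp (|J| * P) :=
    le_of_mul_le_mul_right (by nlinarith [h3]) hW2pos
  rw [Real.exp_neg]
  calc (Real.exp (|J| * P))⁻¹ *
        ((∫ g, Real.exp (J * (ρ g).trace.re) ∂haarProbability G) ^ (Fintype.card (Edge k L) - L) * lam ^ L)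
      ≤ (Real.exp (|J| * P))⁻¹ * (tubeSectorNorm ρ z J k L (Pi.single μ 1) * Real.exp (|J| * P)) :=
        mul_le_mul_of_nonneg_left h4 (inv_nonneg.2 hexp.le)
    _ = tubeSectorNorm ρ z J k L (Pi.single μ 1) := by
        field_simp

/-- **Two-sided envelope, general form**: `E_{ê_μ} ≤ 2 |J| n P + L (log c₀ − log λ)` for `λ > 0`
(`‖T‖ ≤ e^{|J| n P} c₀^N` and `‖T ∘ P_{ê_μ}‖ ≥ e^{−|J| n P} c₀^{N−L} λ^L`). [folklore] -/
theorem torelonEnergy_le_envelope (hρ : Continuous ρ) (hρu : ∀ g, ρ g ∈ Matrix.unitaryGroup (Fin n) ℂ) (hn : n ≠ 0)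
    {z : G} (hz : z ∈ Subgroup.center G) (hρz : ρ z = -1) {lam : ℝ} (hlam : 0 < lam)
    (hM : ∀ i j, ∫ c, (Real.exp (J * (ρ c).trace.re) : ℂ) * ρ c i j ∂haarProbability G = if i = j then (lam : ℂ) else 0)
    (μ : Fin k) :
    torelonEnergy ρ z J k L μ ≤ 2 * (|J| * (n * Fintype.card (Plaquette k L))) +
      (L : ℝ) * (Real.log (∫ g, Real.exp (J * (ρ g).trace.re) ∂haarProbability G) - Real.log lam) := by
  set c0 : ℝ := ∫ g, Real.exp (J * (ρ g).trace.re) ∂haarProbability G with hc0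
  set P : ℝ := n * Fintype.card (Plaquette k L) with hP
  have hc0pos : 0 < c0 :=
    integral_exp_pos ((Real.continuous_exp.comp (continuous_const.mul
      (Complex.continuous_re.comp hρ.matrix_trace))).integrable_of_hasCompactSupport (HasCompactSupport.of_compactSpace _))
  have hLN : L ≤ Fintype.card (Edge k L) := by
    have h := Fintype.card_le_of_injective _ (line_injective (k := k) (L := L) μ)
    rwa [Fintype.card_fin] at h
  have hup := norm_tubeTransferOperator_le ρ J (k := k) (L := L) hρ hρu
  have hlow := tubeSectorNorm_single_ge ρ J (L := L) hρ hρu hn hz hρz hM μ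
  have hTpos : 0 < ‖tubeTransferOperator ρ J k L‖ := norm_tubeTransferOperator_pos J k L hρ
  have hlowpos : 0 < Real.exp (-(|J| * P)) * (c0 ^ (Fintype.card (Edge k L) - L) * lam ^ L) :=
    mul_pos (Real.exp_pos _) (mul_pos (pow_pos hc0pos _) (pow_pos hlam _))
  unfold torelonEnergy tubeFluxEnergy fluxEnergy
  rw [show sectorNorm (tubeTransferOperator ρ J k L) (fluxTwistOp k L z) (Pi.single μ 1) =
      tubeSectorNorm ρ z J k L (Pi.single μ 1) from rfl]
  have h1 : Real.log ‖tubeTransferOperator ρ J k L‖ ≤ |J| * P + (Fintype.card (Edge k L) : ℝ) * Real.log c0 := by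
    have h := Real.log_le_log hTpos hup
    rwa [Real.log_mul (Real.exp_pos _).ne' (pow_pos hc0pos _).ne', Real.log_exp, Real.log_pow] at h
  have h2 : -(|J| * P) + (((Fintype.card (Edge k L) - L : ℕ) : ℝ) * Real.log c0 + (L : ℝ) * Real.log lam) ≤
      Real.log (tubeSectorNorm ρ z J k L (Pi.single μ 1)) := by
    have h := Real.log_le_log hlowpos hlow
    rwa [Real.log_mul (Real.exp_pos _).ne' (mul_pos (pow_pos hc0pos _) (pow_pos hlam _)).ne', Real.log_exp,
      Real.log_mul (pow_pos hc0pos _).ne' (pow_pos hlam _).ne', Real.log_pow, Real.log_pow] at h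
  have hcast : (((Fintype.card (Edge k L) - L : ℕ) : ℝ)) = (Fintype.card (Edge k L) : ℝ) - L := by
    rw [Nat.cast_sub hLN]
  rw [hcast] at h2
  nlinarith [h1, h2]

end Envelope

/-! ### The cell's object: `E₁ ≤ L · (−ln u(β)) + 2β · #plaquettes` -/

section SU2

open Literature.MathematicalPhysics.QuantumLattice (fundamentalRep continuous_fundamentalRep fundamentalRep_mem_unitaryGroup
  secondCountableTopology_su2)
open Summit.Ventures.LatticeQCDFlow.Exactness (su2a0)
open Summit.Ventures.LatticeQCDFlow.Scoring (onePlaquetteZSU2 onePlaquetteExpectSU2 onePlaquetteZSU2_pos)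
open Summit.Ventures.YMGap.Conjectures (su2CharacterRatio su2CharacterRatio_pos)

/-- **The envelope for the cell's torelon energy**: on every cubic tube `(ℤ/L)^k`, every axis, every `β > 0`,
`su2TorelonEnergy β k L μ ≤ L · (−ln u(β)) + 2β · #(Plaquette k L)` — the strong-coupling value plus `2β` per
spatial plaquette (for `k = 1` there are no plaquettes and this is the d = 2 anchor).  Together with
`su2TorelonEnergy_pos'`: `0 < E₁ ≤ L(−ln u) + 2βP`.  A crude a-priori bound, NOT the law «L-Y3-σ».
[cite: MontvayMunster1994, §3.2.6] -/
theorem su2TorelonEnergy_le_envelope {β : ℝ} (hβ : 0 < β) (k L : ℕ) [NeZero L] (μ : Fin k) :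
    su2TorelonEnergy β k L μ ≤
      (L : ℝ) * (-Real.log (su2CharacterRatio β)) + 2 * β * Fintype.card (Plaquette k L) := by
  haveI : SecondCountableTopology (Matrix.specialUnitaryGroup (Fin 2) ℂ) := secondCountableTopology_su2
  have hc0 : (∫ g : Matrix.specialUnitaryGroup (Fin 2) ℂ, Real.exp (β / 2 * ((fundamentalRep (Fin 2) g).trace).re)
      ∂haarProbability (Matrix.specialUnitaryGroup (Fin 2) ℂ)) =
      ∫ U : Matrix.specialUnitaryGroup (Fin 2) ℂ, Real.exp (2 * (β / 2) * su2a0 U)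
        ∂haarProbability (Matrix.specialUnitaryGroup (Fin 2) ℂ) :=
    integral_congr_ae (Eventually.of_forall fun U => su2_weight_eq (β / 2) U)
  have hu : (∫ U : Matrix.specialUnitaryGroup (Fin 2) ℂ, Real.exp (2 * (β / 2) * su2a0 U) * su2a0 U
      ∂haarProbability (Matrix.specialUnitaryGroup (Fin 2) ℂ)) /
      (∫ U : Matrix.specialUnitaryGroup (Fin 2) ℂ, Real.exp (2 * (β / 2) * su2a0 U)
        ∂haarProbability (Matrix.specialUnitaryGroup (Fin 2) ℂ)) = su2CharacterRatio β := by
    rw [su2_schurScalar_div_weightMass (β / 2)]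
    change Summit.Ventures.LatticeQCDFlow.Scoring.onePlaquetteExpectSU2 (2 * (β / 2)) Real.cos =
      Summit.Ventures.LatticeQCDFlow.Scoring.onePlaquetteExpectSU2 β Real.cos
    rw [show 2 * (β / 2) = β by ring]
  have hc0pos := su2_weightMass_pos (β / 2)
  have hupos : 0 < su2CharacterRatio β := su2CharacterRatio_pos hβ
  have hlampos : 0 < ∫ U : Matrix.specialUnitaryGroup (Fin 2) ℂ, Real.exp (2 * (β / 2) * su2a0 U) * su2a0 U
      ∂haarProbability (Matrix.specialUnitaryGroup (Fin 2) ℂ) := by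
    have h := div_mul_cancel₀ (∫ U : Matrix.specialUnitaryGroup (Fin 2) ℂ, Real.exp (2 * (β / 2) * su2a0 U) * su2a0 U
      ∂haarProbability (Matrix.specialUnitaryGroup (Fin 2) ℂ)) hc0pos.ne'
    rw [hu] at h
    rw [← h]
    exact mul_pos hupos hc0pos
  have h := torelonEnergy_le_envelope (fundamentalRep (Fin 2)) (β / 2) (L := L) (continuous_fundamentalRep (Fin 2))
    fundamentalRep_mem_unitaryGroup two_ne_zero su2MinusOne_mem_center fundamentalRep_su2MinusOne hlampos
    (su2_integral_exp_mul_apply (β / 2)) μ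
  have key : Real.log (∫ g : Matrix.specialUnitaryGroup (Fin 2) ℂ,
      Real.exp (β / 2 * ((fundamentalRep (Fin 2) g).trace).re) ∂haarProbability (Matrix.specialUnitaryGroup (Fin 2) ℂ)) -
      Real.log (∫ U : Matrix.specialUnitaryGroup (Fin 2) ℂ, Real.exp (2 * (β / 2) * su2a0 U) * su2a0 U
        ∂haarProbability (Matrix.specialUnitaryGroup (Fin 2) ℂ)) = -Real.log (su2CharacterRatio β) := by
    rw [hc0, ← neg_sub, ← Real.log_div hlampos.ne' hc0pos.ne', hu]
  rw [key] at h
  have hJ : 2 * (|β / 2| * ((2 : ℕ) * (Fintype.card (Plaquette k L) : ℝ))) = 2 * β * Fintype.card (Plaquette k L) := by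
    rw [abs_of_pos (half_pos hβ)]; push_cast; ring
  rw [hJ] at h
  unfold su2TorelonEnergy
  linarith

end SU2


end Summit.Ventures.YMGap.FlowData
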